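import Literature.Analysis.PDE.DbarCarlemanEstimate
import Mathlib.Analysis.Calculus.BumpFunction.InnerProduct
import Mathlib.Analysis.InnerProductSpace.Calculus
import Mathlib.MeasureTheory.Measure.OpenPos
import HarnessLib

/-!
# Weak unique continuation for the differential inequality `‖∂ₓw + J ∂_y w‖ ≤ C ‖w‖`

Let `E` be a real inner product space, `J : E →L[ℝ] E` a constant complex structure (`J² = -1`)
and `w : ℂ → E` of class `C²` on a disc `ball z₁ R` with

  `‖∂ₓ w (z) + J ∂_y w (z)‖ ≤ C ‖w z‖`  on the disc

(`∂ₓ = fderiv ℝ · z 1`, `∂_y = fderiv ℝ · z I`). If `w` vanishes on a neighbourhood of some point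
`a` with `dist a z₁ < R/4`, then `w` vanishes on a neighbourhood of `z₁`
(`dbar_weak_unique_continuation`). This is Carleman's unique continuation theorem for first-order
elliptic systems in two variables (T. Carleman 1939), in the weak (open-set) form, proved by the
weighted `L²` method: with the cut-off `W = χ w` (`χ = 1` on `ball a (R/3)`, supported in
`closedBall a (R/2)`) and the radially decreasing weight `φ = (ε + |z-a|²)⁻¹`, `ε = r²/2`
(strictly subharmonic where `|z - a| ≥ r`, `Δφ = 4(|z-a|² - ε)/(ε+|z-a|²)³`), Carleman's
inequality `τ∫Δφ e^{2τφ} Q(W) ≤ ∫ e^{2τφ} Q(∂ₓW + J∂_yW)` of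
`Literature/Analysis/PDE/DbarCarlemanEstimate.lean` (`Q(b) = ‖b‖² + ‖Jb‖²`) gives
`(τ m - K C²) ∫ e^{2τφ} Q(W) ≤ e^{2τφ₁} M` with `φ₁ = φ|_{|z-a| = R/3}`, whence
`∫_{ball a (R/3)} Q(W) ≤ M / (τ m - K C²) → 0`: `w = W = 0` on `ball a (R/3) ∋ z₁`.

References: T. Carleman, Ark. Mat. Astr. Fys. 26B (1939) no. 17; L. Hörmander, *The Analysis of
Linear Partial Differential Operators* III (1985), §17.2. Consumer: McDuff's unique continuation
lemma for `J`-holomorphic curves (`Literature.Geometry.Symplectic`).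
-/

noncomputable section

open MeasureTheory Complex Function Metric Filter Set
open scoped Topology

namespace Literature.Analysis.PDE.DbarCarleman

/-! ### The weight `φ(z) = (ε + |z - a|²)⁻¹` -/

section Weight

variable (a : ℂ) {ε : ℝ}

/-- `|w - a|²` in coordinates. [folklore] -/
theorem norm_sub_sq_eq_re_im (w : ℂ) :
    ‖w - a‖ ^ 2 = (w - a).re ^ 2 + (w - a).im ^ 2 := by
  rw [Complex.sq_norm, Complex.normSq_apply]; ring

/-- The weight `φ(z) = (ε + |z-a|²)⁻¹` is `C^∞` for `ε > 0`. [folklore] -/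
theorem contDiff_weight (hε : 0 < ε) {n : WithTop ℕ∞} :
    ContDiff ℝ n (fun z : ℂ => (ε + ‖z - a‖ ^ 2)⁻¹) := by
  have h : ContDiff ℝ n (fun z : ℂ => ε + ‖z - a‖ ^ 2) :=
    contDiff_const.add ((contDiff_id.sub contDiff_const).norm_sq ℝ)
  exact h.inv fun z => by positivity

/-- First derivatives of the weight: with `s = ε + |z-a|²`,
`dφ(z) ζ = -(s²)⁻¹ · 2⟪z - a, ζ⟫`. [folklore] -/
theorem hasFDerivAt_weight (hε : 0 < ε) (z : ℂ) :
    HasFDerivAt (fun w : ℂ => (ε + ‖w - a‖ ^ 2)⁻¹)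
      ((-((ε + ‖z - a‖ ^ 2) ^ 2)⁻¹) • ((2 : ℕ) • innerSL ℝ (z - a))) z := by
  have hs : HasFDerivAt (fun w : ℂ => ε + ‖w - a‖ ^ 2) ((2 : ℕ) • innerSL ℝ (z - a)) z := by
    have h := ((hasStrictFDerivAt_norm_sq (z - a)).hasFDerivAt).comp z
      ((hasFDerivAt_id z).sub_const a)
    have h' := h.const_add ε
    simpa [Function.comp_def] using h'
  have hne : ε + ‖z - a‖ ^ 2 ≠ 0 := by positivity
  exact (hasDerivAt_inv hne).comp_hasFDerivAt z hs

/-- `∂ₓφ (z) = -2 (z-a).re / s²`. [folklore] -/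
theorem fderiv_weight_one (hε : 0 < ε) (z : ℂ) :
    fderiv ℝ (fun w : ℂ => (ε + ‖w - a‖ ^ 2)⁻¹) z 1
      = -((ε + ‖z - a‖ ^ 2) ^ 2)⁻¹ * (2 * (z - a).re) := by
  rw [(hasFDerivAt_weight a hε z).fderiv]
  simp [Complex.inner]

/-- `∂_yφ (z) = -2 (z-a).im / s²`. [folklore] -/
theorem fderiv_weight_I (hε : 0 < ε) (z : ℂ) :
    fderiv ℝ (fun w : ℂ => (ε + ‖w - a‖ ^ 2)⁻¹) z I
      = -((ε + ‖z - a‖ ^ 2) ^ 2)⁻¹ * (2 * (z - a).im) := by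
  rw [(hasFDerivAt_weight a hε z).fderiv]
  simp [Complex.inner]

/-- The derivative of `z ↦ (s z ^ 2)⁻¹`, `s = ε + |z-a|²`. [folklore] -/
theorem hasFDerivAt_weight_sq_inv (hε : 0 < ε) (z : ℂ) :
    HasFDerivAt (fun w : ℂ => ((ε + ‖w - a‖ ^ 2) ^ 2)⁻¹)
      ((-((((ε + ‖z - a‖ ^ 2) ^ 2)) ^ 2)⁻¹) •
        (((2 : ℕ) • (ε + ‖z - a‖ ^ 2) ^ (2 - 1)) • ((2 : ℕ) • innerSL ℝ (z - a)))) z := by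
  have hs : HasFDerivAt (fun w : ℂ => ε + ‖w - a‖ ^ 2) ((2 : ℕ) • innerSL ℝ (z - a)) z := by
    have h := ((hasStrictFDerivAt_norm_sq (z - a)).hasFDerivAt).comp z
      ((hasFDerivAt_id z).sub_const a)
    have h' := h.const_add ε
    simpa [Function.comp_def] using h'
  have hne : (ε + ‖z - a‖ ^ 2) ^ 2 ≠ 0 := by positivity
  exact (hasDerivAt_inv hne).comp_hasFDerivAt z (hs.pow 2)

/-- `∂ₓ∂ₓφ (z) = -2/s² + 8 (z-a).re² / s³`. [folklore] -/
theorem fderiv_fderiv_weight_one (hε : 0 < ε) (z : ℂ) :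
    fderiv ℝ (fun w => fderiv ℝ (fun w : ℂ => (ε + ‖w - a‖ ^ 2)⁻¹) w 1) z 1
      = -2 / (ε + ‖z - a‖ ^ 2) ^ 2 + 8 * (z - a).re ^ 2 / (ε + ‖z - a‖ ^ 2) ^ 3 := by
  have hfun : (fun w => fderiv ℝ (fun w : ℂ => (ε + ‖w - a‖ ^ 2)⁻¹) w 1)
      = fun w => ((ε + ‖w - a‖ ^ 2) ^ 2)⁻¹ * (-2 * (w - a).re) := by
    funext w; rw [fderiv_weight_one a hε w]; ring
  rw [hfun]
  have hre : HasFDerivAt (fun w : ℂ => -2 * (w - a).re)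
      ((-2 : ℝ) • reCLM.comp (ContinuousLinearMap.id ℝ ℂ)) z :=
    (reCLM.hasFDerivAt.comp z ((hasFDerivAt_id z).sub_const a)).const_mul (-2 : ℝ)
  have hprod : HasFDerivAt (fun w : ℂ => ((ε + ‖w - a‖ ^ 2) ^ 2)⁻¹ * (-2 * (w - a).re)) _ z :=
    (hasFDerivAt_weight_sq_inv a hε z).mul hre
  rw [hprod.fderiv]
  have hne : ε + ‖z - a‖ ^ 2 ≠ 0 := by positivity
  simp [Complex.inner]
  field_simp
  ring

/-- `∂_y∂_yφ (z) = -2/s² + 8 (z-a).im² / s³`. [folklore] -/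
theorem fderiv_fderiv_weight_I (hε : 0 < ε) (z : ℂ) :
    fderiv ℝ (fun w => fderiv ℝ (fun w : ℂ => (ε + ‖w - a‖ ^ 2)⁻¹) w I) z I
      = -2 / (ε + ‖z - a‖ ^ 2) ^ 2 + 8 * (z - a).im ^ 2 / (ε + ‖z - a‖ ^ 2) ^ 3 := by
  have hfun : (fun w => fderiv ℝ (fun w : ℂ => (ε + ‖w - a‖ ^ 2)⁻¹) w I)
      = fun w => ((ε + ‖w - a‖ ^ 2) ^ 2)⁻¹ * (-2 * (w - a).im) := by
    funext w; rw [fderiv_weight_I a hε w]; ring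
  rw [hfun]
  have him : HasFDerivAt (fun w : ℂ => -2 * (w - a).im)
      ((-2 : ℝ) • imCLM.comp (ContinuousLinearMap.id ℝ ℂ)) z :=
    (imCLM.hasFDerivAt.comp z ((hasFDerivAt_id z).sub_const a)).const_mul (-2 : ℝ)
  have hprod : HasFDerivAt (fun w : ℂ => ((ε + ‖w - a‖ ^ 2) ^ 2)⁻¹ * (-2 * (w - a).im)) _ z :=
    (hasFDerivAt_weight_sq_inv a hε z).mul him
  rw [hprod.fderiv]
  have hne : ε + ‖z - a‖ ^ 2 ≠ 0 := by positivity
  simp [Complex.inner]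
  field_simp
  ring

/-- **Laplacian of the weight**: `Δφ (z) = 4 (|z-a|² - ε) / (ε + |z-a|²)³`; in particular `φ`
is strictly subharmonic where `|z - a|² > ε`. [folklore] -/
theorem laplacian_weight (hε : 0 < ε) (z : ℂ) :
    fderiv ℝ (fun w => fderiv ℝ (fun w : ℂ => (ε + ‖w - a‖ ^ 2)⁻¹) w 1) z 1
      + fderiv ℝ (fun w => fderiv ℝ (fun w : ℂ => (ε + ‖w - a‖ ^ 2)⁻¹) w I) z I
      = 4 * (‖z - a‖ ^ 2 - ε) / (ε + ‖z - a‖ ^ 2) ^ 3 := by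
  rw [fderiv_fderiv_weight_one a hε z, fderiv_fderiv_weight_I a hε z]
  have hne : ε + ‖z - a‖ ^ 2 ≠ 0 := by positivity
  rw [norm_sub_sq_eq_re_im] at hne ⊢
  field_simp
  ring

/-- Lower bound for the Laplacian of the weight on the annulus `r ≤ |z - a| ≤ ρ₂` when
`ε = r²/2`: `Δφ ≥ 4ε / (ε + ρ₂²)³`. [folklore] -/
theorem laplacian_weight_lower {r ρ₂ : ℝ} (hr : 0 < r) (z : ℂ) (h1 : r ≤ ‖z - a‖)
    (h2 : ‖z - a‖ ≤ ρ₂) :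
    4 * (r ^ 2 / 2) / (r ^ 2 / 2 + ρ₂ ^ 2) ^ 3
      ≤ 4 * (‖z - a‖ ^ 2 - r ^ 2 / 2) / (r ^ 2 / 2 + ‖z - a‖ ^ 2) ^ 3 := by
  have hr2 : r ^ 2 ≤ ‖z - a‖ ^ 2 := pow_le_pow_left₀ hr.le h1 2
  have hρ2 : ‖z - a‖ ^ 2 ≤ ρ₂ ^ 2 := pow_le_pow_left₀ (norm_nonneg _) h2 2
  have hA : 0 < r ^ 2 / 2 + ‖z - a‖ ^ 2 := by positivity
  have hB : r ^ 2 / 2 + ‖z - a‖ ^ 2 ≤ r ^ 2 / 2 + ρ₂ ^ 2 := by linarith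
  calc 4 * (r ^ 2 / 2) / (r ^ 2 / 2 + ρ₂ ^ 2) ^ 3
      ≤ 4 * (r ^ 2 / 2) / (r ^ 2 / 2 + ‖z - a‖ ^ 2) ^ 3 := by
        gcongr
    _ ≤ 4 * (‖z - a‖ ^ 2 - r ^ 2 / 2) / (r ^ 2 / 2 + ‖z - a‖ ^ 2) ^ 3 := by
        gcongr
        linarith

end Weight

/-! ### The bilinear form `g(a, b) = ⟪a, b⟫ + ⟪Ja, Jb⟫` -/

section Form

variable {E : Type*} [NormedAddCommGroup E] [InnerProductSpace ℝ E] (J : E →L[ℝ] E)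

/-- The continuous bilinear form `g(a,b) = ⟪a,b⟫ + ⟪Ja,Jb⟫` exists as an element of
`E →L[ℝ] E →L[ℝ] ℝ`. [folklore] -/
theorem exists_gForm :
    ∃ g : E →L[ℝ] E →L[ℝ] ℝ, ∀ a b, g a b = inner ℝ a b + inner ℝ (J a) (J b) :=
  ⟨(innerSL ℝ + (innerSL ℝ).bilinearComp J J : E →L[ℝ] E →L[ℝ] ℝ), fun _ _ => rfl⟩

variable {J} {g : E →L[ℝ] E →L[ℝ] ℝ}

/-- `g` is symmetric. [folklore] -/
theorem gForm_symm (hg : ∀ a b, g a b = inner ℝ a b + inner ℝ (J a) (J b)) (a b : E) :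
    g a b = g b a := by
  rw [hg, hg, real_inner_comm a b, real_inner_comm (J a) (J b)]

/-- `J` is skew for `g` when `J² = -1`. [folklore] -/
theorem gForm_skew (hg : ∀ a b, g a b = inner ℝ a b + inner ℝ (J a) (J b))
    (hJ : ∀ a, J (J a) = -a) (a b : E) : g (J a) b = - g a (J b) := by
  rw [hg, hg, hJ, hJ]
  simp only [inner_neg_left, inner_neg_right]
  ring

/-- `g(b,b) = ‖b‖² + ‖Jb‖²`. [folklore] -/
theorem gForm_self (hg : ∀ a b, g a b = inner ℝ a b + inner ℝ (J a) (J b)) (b : E) :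
    g b b = ‖b‖ ^ 2 + ‖J b‖ ^ 2 := by
  rw [hg, real_inner_self_eq_norm_sq, real_inner_self_eq_norm_sq]

/-- `‖b‖² ≤ g(b,b) ≤ (1 + ‖J‖²) ‖b‖²`. [folklore] -/
theorem gForm_self_bounds (hg : ∀ a b, g a b = inner ℝ a b + inner ℝ (J a) (J b)) (b : E) :
    ‖b‖ ^ 2 ≤ g b b ∧ g b b ≤ (1 + ‖J‖ ^ 2) * ‖b‖ ^ 2 := by
  rw [gForm_self hg]
  have h1 : ‖J b‖ ≤ ‖J‖ * ‖b‖ := J.le_opNorm b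
  have h2 : ‖J b‖ ^ 2 ≤ (‖J‖ * ‖b‖) ^ 2 := pow_le_pow_left₀ (norm_nonneg _) h1 2
  constructor
  · nlinarith [sq_nonneg ‖J b‖]
  · nlinarith [h2]

end Form

/-! ### Elementary real inequalities used pointwise -/

section Arith

/-- Pointwise lower bound: `m ≤ Δ`, `q ≥ 0`, `τ ≥ 0` give `τ m q ≤ τ Δ q`. [folklore] -/
theorem arith_lower {m Δ q τ : ℝ} (h : m ≤ Δ) (hq : 0 ≤ q) (hτ : 0 ≤ τ) :
    τ * (m * q) ≤ τ * (Δ * q) :=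
  mul_le_mul_of_nonneg_left (mul_le_mul_of_nonneg_right h hq) hτ

/-- From `Q(b) ≤ K‖b‖²`, `‖b‖ ≤ C‖x‖`, `‖x‖² ≤ Q(x)`: `Q(b) ≤ K C² Q(x)`. [folklore] -/
theorem arith_ineq {qb nb nx qx K C : ℝ} (h1 : qb ≤ K * nb ^ 2) (h2 : nb ≤ C * nx)
    (hnb : 0 ≤ nb) (h3 : nx ^ 2 ≤ qx) (hK : 0 ≤ K) : qb ≤ K * C ^ 2 * qx := by
  have h4 : nb ^ 2 ≤ (C * nx) ^ 2 := pow_le_pow_left₀ hnb h2 2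
  have h5 : K * nb ^ 2 ≤ K * (C ^ 2 * nx ^ 2) := by
    apply mul_le_mul_of_nonneg_left _ hK; nlinarith
  have h6 : K * (C ^ 2 * nx ^ 2) ≤ K * (C ^ 2 * qx) := by
    apply mul_le_mul_of_nonneg_left _ hK
    exact mul_le_mul_of_nonneg_left h3 (sq_nonneg C)
  linarith

/-- Inner region: `F ≤ k q`, `e ≥ 0`, `ind ≥ 0` give `e F ≤ k (e q) + ind`. [folklore] -/
theorem arith_inner {F k q e ind : ℝ} (h : F ≤ k * q) (he : 0 ≤ e) (hind : 0 ≤ ind) :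
    e * F ≤ k * (e * q) + ind := by
  nlinarith [mul_le_mul_of_nonneg_left h he]

/-- Annulus: `e ≤ e₁`, `0 ≤ F ≤ M`, `0 ≤ A` give `e F ≤ A + e₁ M`. [folklore] -/
theorem arith_annulus {F M e e₁ A : ℝ} (he : e ≤ e₁) (hF : F ≤ M) (hF0 : 0 ≤ F) (he0 : 0 ≤ e)
    (hA : 0 ≤ A) : e * F ≤ A + e₁ * M := by
  nlinarith [mul_le_mul he hF hF0 (he0.trans he)]

end Arith

/-! ### Weak unique continuation -/

section UCP

variable {E : Type*} [NormedAddCommGroup E] [InnerProductSpace ℝ E]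
set_option maxHeartbeats 400000 in -- buildfix (bf3-g26): 160k/180k FAIL, 200k PASS at accept time; line-neutral budget line
/-- **Weak unique continuation for `‖∂ₓw + J∂_yw‖ ≤ C‖w‖` (Carleman 1939).** Let
`J : E →L[ℝ] E` with `J² = -1`, `w : ℂ → E` of class `C²` on `ball z₁ R` with
`‖∂ₓ w(z) + J ∂_y w(z)‖ ≤ C ‖w(z)‖` there. If `w` vanishes near a point `a` with
`dist a z₁ < R/4`, then `w` vanishes near `z₁` (indeed on `ball a (R/3)`). [folklore] -/
theorem dbar_weak_unique_continuation (J : E →L[ℝ] E) (hJ : ∀ b, J (J b) = -b)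
    {w : ℂ → E} {z₁ : ℂ} {R C : ℝ} (hw : ContDiffOn ℝ 2 w (ball z₁ R))
    (hineq : ∀ z ∈ ball z₁ R, ‖fderiv ℝ w z 1 + J (fderiv ℝ w z I)‖ ≤ C * ‖w z‖)
    {a : ℂ} (ha : dist a z₁ < R / 4) (hwa : ∀ᶠ z in 𝓝 a, w z = 0) :
    ∀ᶠ z in 𝓝 z₁, w z = 0 := by
  have hR : 0 < R := by linarith [dist_nonneg (x := a) (y := z₁)]
  -- a ball around `a` on which `w` vanishes, of radius `r ≤ R/4`
  obtain ⟨r, hr, hrR, hwr⟩ : ∃ r, 0 < r ∧ r ≤ R / 4 ∧ ∀ z, dist z a < r → w z = 0 := by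
    obtain ⟨r₀, hr₀, h⟩ := Metric.eventually_nhds_iff.mp hwa
    exact ⟨min r₀ (R / 4), lt_min hr₀ (by linarith), min_le_right _ _,
      fun z hz => h (lt_of_lt_of_le hz (min_le_left _ _))⟩
  -- radii `r ≤ R/4 < ρ₁ = R/3 < ρ₂ = R/2`
  obtain ⟨ρ₁, hρ₁⟩ : ∃ ρ₁ : ℝ, ρ₁ = R / 3 := ⟨_, rfl⟩
  obtain ⟨ρ₂, hρ₂⟩ : ∃ ρ₂ : ℝ, ρ₂ = R / 2 := ⟨_, rfl⟩
  have hρ₁pos : 0 < ρ₁ := by rw [hρ₁]; positivity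
  have hρ₁₂ : ρ₁ < ρ₂ := by rw [hρ₁, hρ₂]; linarith
  have hrρ₁ : r < ρ₁ := by rw [hρ₁]; linarith
  have hz₁a : dist z₁ a < ρ₁ := by rw [dist_comm, hρ₁]; linarith
  have hball : ∀ z, dist z a ≤ ρ₂ → z ∈ ball z₁ R := by
    intro z hz
    rw [mem_ball]
    calc dist z z₁ ≤ dist z a + dist a z₁ := dist_triangle _ _ _
      _ < R := by rw [hρ₂] at hz; linarith
  -- the cut-off and `W = χ w`
  let χ : ContDiffBump a := ⟨ρ₁, ρ₂, hρ₁pos, hρ₁₂⟩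
  obtain ⟨W, hW_def⟩ : ∃ W : ℂ → E, W = fun z => χ z • w z := ⟨_, rfl⟩
  have hW0far : ∀ z, ρ₂ < dist z a → W =ᶠ[𝓝 z] fun _ => (0 : E) := by
    intro z hz
    have hU : IsOpen {x : ℂ | ρ₂ < dist x a} :=
      isOpen_lt continuous_const (continuous_id.dist continuous_const)
    filter_upwards [hU.mem_nhds hz] with x hx
    have : χ x = 0 := χ.zero_of_le_dist (le_of_lt hx)
    simp [hW_def, this]
  have hWnear : ∀ z, dist z a < ρ₁ → W =ᶠ[𝓝 z] w := by
    intro z hz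
    filter_upwards [isOpen_ball.mem_nhds (mem_ball.mpr hz)] with x hx
    have : χ x = 1 :=
      χ.one_of_mem_closedBall (mem_closedBall.mpr (le_of_lt (mem_ball.mp hx)))
    simp [hW_def, this]
  have hWr : ∀ z, dist z a < r → W =ᶠ[𝓝 z] fun _ => (0 : E) := by
    intro z hz
    filter_upwards [isOpen_ball.mem_nhds (mem_ball.mpr hz)] with x hx
    simp [hW_def, hwr x (mem_ball.mp hx)]
  have hW2 : ContDiff ℝ 2 W := by
    rw [contDiff_iff_contDiffAt]
    intro z
    by_cases hz : dist z a ≤ ρ₂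
    · rw [hW_def]
      exact (χ.contDiff (n := 2)).contDiffAt.smul
        (hw.contDiffAt (isOpen_ball.mem_nhds (hball z hz)))
    · exact (contDiffAt_const (c := (0 : E))).congr_of_eventuallyEq
        (hW0far z (lt_of_not_ge hz))
  have hWc : HasCompactSupport W := by
    refine HasCompactSupport.intro' (isCompact_closedBall a ρ₂) isClosed_closedBall ?_
    intro z hz
    rw [mem_closedBall, not_le] at hz
    exact (hW0far z hz).self_of_nhds
  -- where `W` and its derivative vanish / agree with `w`
  have hWval0 : ∀ z, W z ≠ 0 → r ≤ dist z a ∧ dist z a ≤ ρ₂ := by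
    intro z hz
    constructor
    · by_contra h
      exact hz (hWr z (lt_of_not_ge h)).self_of_nhds
    · by_contra h
      exact hz (hW0far z (lt_of_not_ge h)).self_of_nhds
  have hDWfar : ∀ z, ρ₂ < dist z a → fderiv ℝ W z = 0 := by
    intro z hz
    rw [(hW0far z hz).fderiv_eq]
    simp
  have hDWnear : ∀ z, dist z a < ρ₁ → fderiv ℝ W z = fderiv ℝ w z := fun z hz =>
    (hWnear z hz).fderiv_eq
  -- the bilinear form
  obtain ⟨g, hg⟩ := exists_gForm J
  have hsym : ∀ b b', g b b' = g b' b := gForm_symm hg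
  have hskew : ∀ b b', g (J b) b' = - g b (J b') := gForm_skew hg hJ
  have hpos : ∀ b, 0 ≤ g b b := fun b => by rw [gForm_self hg]; positivity
  obtain ⟨K, hK⟩ : ∃ K : ℝ, K = 1 + ‖J‖ ^ 2 := ⟨_, rfl⟩
  have hKnn : 0 ≤ K := by rw [hK]; positivity
  have hgle : ∀ b, g b b ≤ K * ‖b‖ ^ 2 := fun b => by rw [hK]; exact (gForm_self_bounds hg b).2
  have hlege : ∀ b, ‖b‖ ^ 2 ≤ g b b := fun b => (gForm_self_bounds hg b).1
  -- the weight
  obtain ⟨ε, hε_def⟩ : ∃ ε : ℝ, ε = r ^ 2 / 2 := ⟨_, rfl⟩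
  have hε : 0 < ε := by rw [hε_def]; positivity
  obtain ⟨φ, hφ_def⟩ : ∃ φ : ℂ → ℝ, φ = fun z => (ε + ‖z - a‖ ^ 2)⁻¹ := ⟨_, rfl⟩
  have hφ2 : ContDiff ℝ 2 φ := by rw [hφ_def]; exact contDiff_weight a hε
  obtain ⟨φ₁, hφ₁⟩ : ∃ φ₁ : ℝ, φ₁ = (ε + ρ₁ ^ 2)⁻¹ := ⟨_, rfl⟩
  have hφout : ∀ z, ρ₁ ≤ dist z a → φ z ≤ φ₁ := by
    intro z hz
    rw [dist_eq_norm] at hz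
    rw [hφ_def, hφ₁]
    have : ρ₁ ^ 2 ≤ ‖z - a‖ ^ 2 := pow_le_pow_left₀ hρ₁pos.le hz 2
    exact inv_anti₀ (by positivity) (by linarith)
  have hφin : ∀ z, dist z a < ρ₁ → φ₁ ≤ φ z := by
    intro z hz
    rw [dist_eq_norm] at hz
    rw [hφ_def, hφ₁]
    have : ‖z - a‖ ^ 2 ≤ ρ₁ ^ 2 := pow_le_pow_left₀ (norm_nonneg _) hz.le 2
    exact inv_anti₀ (by positivity) (by linarith)
  -- the subharmonicity constant `m`
  obtain ⟨m, hm⟩ : ∃ m : ℝ, m = 4 * ε / (ε + ρ₂ ^ 2) ^ 3 := ⟨_, rfl⟩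
  have hmpos : 0 < m := by rw [hm]; positivity
  have hΔ : ∀ z, r ≤ dist z a → dist z a ≤ ρ₂ →
      m ≤ fderiv ℝ (fun w => fderiv ℝ φ w 1) z 1 + fderiv ℝ (fun w => fderiv ℝ φ w I) z I := by
    intro z h1 h2
    rw [dist_eq_norm] at h1 h2
    rw [hφ_def, laplacian_weight a hε z, hm, hε_def]
    exact laplacian_weight_lower a hr z h1 h2
  -- continuity, and the bound `M₀` for `F = Q(∂ₓW + J∂_yW)`
  have hcW : Continuous W := hW2.continuous
  have hcDW : Continuous (fderiv ℝ W) := hW2.continuous_fderiv (by norm_num)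
  have hcφ : Continuous φ := hφ2.continuous
  obtain ⟨F, hF⟩ : ∃ F : ℂ → ℝ, ∀ z, F z = g (fderiv ℝ W z 1 + J (fderiv ℝ W z I))
      (fderiv ℝ W z 1 + J (fderiv ℝ W z I)) := ⟨_, fun z => rfl⟩
  have hFfun : F = fun z => g (fderiv ℝ W z 1 + J (fderiv ℝ W z I))
      (fderiv ℝ W z 1 + J (fderiv ℝ W z I)) := funext hF
  have hcF : Continuous F := by rw [hFfun]; fun_prop
  have hF0 : ∀ z, fderiv ℝ W z = 0 → F z = 0 := fun z hz => by rw [hF, hz]; simp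
  have hFnn : ∀ z, 0 ≤ F z := fun z => by rw [hF]; exact hpos _
  have hFc : HasCompactSupport F :=
    hasCompactSupport_of_notMem_tsupport hWc fun z hz =>
      hF0 z (fderiv_eq_zero_of_notMem_tsupport hz)
  obtain ⟨M₀', hM₀'⟩ := hcF.bounded_above_of_compact_support hFc
  obtain ⟨M₀, hM₀⟩ : ∃ M₀ : ℝ, M₀ = max M₀' 0 := ⟨_, rfl⟩
  have hM₀nn : 0 ≤ M₀ := by rw [hM₀]; exact le_max_right _ _
  have hFle : ∀ z, F z ≤ M₀ := fun z => by
    rw [hM₀]; exact ((Real.le_norm_self _).trans (hM₀' z)).trans (le_max_left _ _)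
  -- finite volume of the big ball
  obtain ⟨vol, hvol⟩ : ∃ vol : ℝ, vol = volume.real (closedBall a ρ₂) := ⟨_, rfl⟩
  have hvolnn : 0 ≤ vol := by rw [hvol]; exact measureReal_nonneg
  -- integrability of `Q(W)` and the quantity to kill, `Iρ = ∫_{ball a ρ₁} Q(W)`
  have hQint : Integrable fun z => g (W z) (W z) :=
    integrable_of_continuous_of_tsupport hWc (by fun_prop) fun z hz => by
      simp [image_eq_zero_of_notMem_tsupport hz]
  obtain ⟨Iρ, hIρ⟩ : ∃ Iρ : ℝ, Iρ = ∫ z in ball a ρ₁, g (W z) (W z) := ⟨_, rfl⟩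
  have hIρnn : 0 ≤ Iρ := by
    rw [hIρ]; exact setIntegral_nonneg measurableSet_ball fun z _ => hpos (W z)
  -- ** the main estimate: for every `T > 0`, `T * Iρ ≤ M₀ * vol` **
  have hmain : ∀ T : ℝ, 0 < T → T * Iρ ≤ M₀ * vol := by
    intro T hT
    obtain ⟨τ, hτ⟩ : ∃ τ : ℝ, τ = (K * C ^ 2 + T) / m := ⟨_, rfl⟩
    have hτpos : 0 < τ := by rw [hτ]; positivity
    have hτm : τ * m = K * C ^ 2 + T := by rw [hτ]; field_simp
    -- Carleman's inequality for `W`, `φ`, `τ`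
    have hCar := carleman_dbar_estimate J g hJ hsym hskew hpos hW2 hWc hφ2 τ
    simp only [← hF] at hCar
    have hexpos : ∀ z, 0 < Real.exp (2 * τ * φ z) := fun z => Real.exp_pos _
    have hIint : Integrable fun z => Real.exp (2 * τ * φ z) * g (W z) (W z) :=
      integrable_of_continuous_of_tsupport hWc (by fun_prop) fun z hz => by
        simp [image_eq_zero_of_notMem_tsupport hz]
    obtain ⟨Iτ, hIτ⟩ : ∃ Iτ : ℝ, Iτ = ∫ z, Real.exp (2 * τ * φ z) * g (W z) (W z) := ⟨_, rfl⟩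
    -- (1) lower bound of the left-hand side: `τ m Iτ ≤ τ ∫ Δφ e^{2τφ} Q(W)`
    have hL : τ * m * Iτ ≤ τ * ∫ z, (fderiv ℝ (fun w => fderiv ℝ φ w 1) z 1
        + fderiv ℝ (fun w => fderiv ℝ φ w I) z I) * (Real.exp (2 * τ * φ z) * g (W z) (W z)) := by
      rw [hIτ, mul_assoc, ← integral_const_mul, ← integral_const_mul, ← integral_const_mul]
      refine integral_mono ((hIint.const_mul m).const_mul τ) ?_ fun z => ?_
      · have hc : Continuous fun z => (fderiv ℝ (fun w => fderiv ℝ φ w 1) z 1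
            + fderiv ℝ (fun w => fderiv ℝ φ w I) z I) := by
          have h1 : ContDiff ℝ 1 fun w => fderiv ℝ φ w 1 :=
            (hφ2.fderiv_right (m := 1) (by norm_num)).clm_apply contDiff_const
          have h2 : ContDiff ℝ 1 fun w => fderiv ℝ φ w I :=
            (hφ2.fderiv_right (m := 1) (by norm_num)).clm_apply contDiff_const
          exact ((h1.continuous_fderiv one_ne_zero).clm_apply continuous_const).add
            ((h2.continuous_fderiv one_ne_zero).clm_apply continuous_const)
        exact (integrable_of_continuous_of_tsupport hWc (hc.mul (by fun_prop)) fun z hz => by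
          simp [image_eq_zero_of_notMem_tsupport hz]).const_mul τ
      · dsimp only
        by_cases hWz : W z = 0
        · simp [hWz]
        · obtain ⟨h1, h2⟩ := hWval0 z hWz
          exact arith_lower (hΔ z h1 h2) (mul_nonneg (hexpos z).le (hpos _)) hτpos.le
    -- (2) upper bound of the right-hand side
    have hRint1 : Integrable fun z => K * C ^ 2 * (Real.exp (2 * τ * φ z) * g (W z) (W z)) :=
      hIint.const_mul _
    have hRint2 : Integrable
        ((closedBall a ρ₂).indicator fun _ => Real.exp (2 * τ * φ₁) * M₀) := by
      rw [integrable_indicator_iff measurableSet_closedBall]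
      exact integrableOn_const measure_closedBall_lt_top.ne
    have hU : ∫ z, Real.exp (2 * τ * φ z) * F z
        ≤ K * C ^ 2 * Iτ + Real.exp (2 * τ * φ₁) * M₀ * vol := by
      have hsplit : (∫ z, K * C ^ 2 * (Real.exp (2 * τ * φ z) * g (W z) (W z)))
          + ∫ z, (closedBall a ρ₂).indicator (fun _ => Real.exp (2 * τ * φ₁) * M₀) z
          = K * C ^ 2 * Iτ + Real.exp (2 * τ * φ₁) * M₀ * vol := by
        rw [integral_const_mul, integral_indicator_const _ measurableSet_closedBall, hvol, hIτ,
          smul_eq_mul]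
        ring
      rw [← hsplit, ← integral_add hRint1 hRint2]
      refine integral_mono ?_ (hRint1.add hRint2) fun z => ?_
      · exact integrable_of_continuous_of_tsupport hWc (by fun_prop) fun z hz => by
          rw [hF0 z (fderiv_eq_zero_of_notMem_tsupport hz), mul_zero]
      · dsimp only
        have hind0 : 0 ≤ (closedBall a ρ₂).indicator (fun _ => Real.exp (2 * τ * φ₁) * M₀) z :=
          Set.indicator_nonneg (fun _ _ => by positivity) z
        by_cases hz1 : dist z a < ρ₁
        · -- inner region: the differential inequality
          have hzR : z ∈ ball z₁ R := hball z (by linarith)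
          have hFz : F z ≤ K * C ^ 2 * g (W z) (W z) := by
            rw [hF, hDWnear z hz1, (hWnear z hz1).self_of_nhds]
            exact arith_ineq (hgle _) (hineq z hzR) (norm_nonneg _) (hlege _) hKnn
          exact arith_inner hFz (hexpos z).le hind0
        · rw [not_lt] at hz1
          have hA : 0 ≤ K * C ^ 2 * (Real.exp (2 * τ * φ z) * g (W z) (W z)) :=
            mul_nonneg (mul_nonneg hKnn (sq_nonneg C)) (mul_nonneg (hexpos z).le (hpos _))
          by_cases hz2 : dist z a ≤ ρ₂
          · -- annulus: weight at most `e^{2τφ₁}`, `F ≤ M₀`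
            rw [Set.indicator_of_mem (mem_closedBall.mpr hz2)]
            have hexle : Real.exp (2 * τ * φ z) ≤ Real.exp (2 * τ * φ₁) :=
              Real.exp_le_exp.mpr
                (mul_le_mul_of_nonneg_left (hφout z hz1) (by positivity))
            exact arith_annulus hexle (hFle z) (hFnn z) (hexpos z).le hA
          · -- outside: `F = 0`
            rw [not_le] at hz2
            rw [hF0 z (hDWfar z hz2), mul_zero]
            exact add_nonneg hA hind0
    -- (3) chain with Carleman: `τ m Iτ ≤ K C² Iτ + e^{2τφ₁} M₀ vol`
    have hchain : τ * m * Iτ ≤ K * C ^ 2 * Iτ + Real.exp (2 * τ * φ₁) * M₀ * vol :=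
      hL.trans (hCar.trans hU)
    -- (4) lower bound `e^{2τφ₁} Iρ ≤ Iτ`
    have hIρle : Real.exp (2 * τ * φ₁) * Iρ ≤ Iτ := by
      have hind : ∫ z, (ball a ρ₁).indicator
          (fun z => Real.exp (2 * τ * φ₁) * g (W z) (W z)) z = Real.exp (2 * τ * φ₁) * Iρ := by
        rw [integral_indicator measurableSet_ball, integral_const_mul, hIρ]
      rw [← hind, hIτ]
      refine integral_mono ?_ hIint fun z => ?_
      · rw [integrable_indicator_iff measurableSet_ball]
        exact (hQint.const_mul (Real.exp (2 * τ * φ₁))).integrableOn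
      · dsimp only
        by_cases hz : z ∈ ball a ρ₁
        · rw [Set.indicator_of_mem hz]
          have hexge : Real.exp (2 * τ * φ₁) ≤ Real.exp (2 * τ * φ z) :=
            Real.exp_le_exp.mpr
              (mul_le_mul_of_nonneg_left (hφin z (mem_ball.mp hz)) (by positivity))
          exact mul_le_mul_of_nonneg_right hexge (hpos _)
        · rw [Set.indicator_of_notMem hz]
          exact mul_nonneg (hexpos z).le (hpos _)
    -- (5) conclude `T Iρ ≤ M₀ vol`
    have hE : 0 < Real.exp (2 * τ * φ₁) := Real.exp_pos _
    have h1 : T * Iτ ≤ Real.exp (2 * τ * φ₁) * (M₀ * vol) := by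
      have h := hchain
      rw [hτm] at h
      nlinarith [h]
    have h2 : Real.exp (2 * τ * φ₁) * (T * Iρ) ≤ Real.exp (2 * τ * φ₁) * (M₀ * vol) := by
      nlinarith [mul_le_mul_of_nonneg_left hIρle hT.le]
    exact le_of_mul_le_mul_left h2 hE
  -- hence `Iρ = 0`
  have hIρ0 : Iρ = 0 := by
    by_contra hne
    have hIρpos : 0 < Iρ := lt_of_le_of_ne hIρnn (Ne.symm hne)
    have hMv : 0 ≤ M₀ * vol := mul_nonneg hM₀nn hvolnn
    have h := hmain ((M₀ * vol + 1) / Iρ) (by positivity)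
    rw [div_mul_cancel₀ _ (ne_of_gt hIρpos)] at h
    linarith
  -- hence `Q(W) = 0` on `ball a ρ₁`
  have hae : (fun z => g (W z) (W z)) =ᵐ[volume.restrict (ball a ρ₁)] 0 :=
    (setIntegral_eq_zero_iff_of_nonneg_ae (Eventually.of_forall fun z => hpos (W z))
      hQint.integrableOn).mp (by rw [← hIρ]; exact hIρ0)
  have hEq : EqOn (fun z => g (W z) (W z)) 0 (ball a ρ₁) :=
    Measure.eqOn_open_of_ae_eq hae isOpen_ball (by fun_prop) continuousOn_const
  -- conclusion: `w = W = 0` on `ball a ρ₁ ∋ z₁`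
  filter_upwards [isOpen_ball.mem_nhds (mem_ball.mpr hz₁a)] with z hz
  have hq : g (W z) (W z) = 0 := hEq hz
  have hWz : W z = 0 := by
    have h := hlege (W z)
    rw [hq] at h
    have : ‖W z‖ = 0 := le_antisymm (by nlinarith [norm_nonneg (W z)]) (norm_nonneg _)
    exact norm_eq_zero.mp this
  rw [← (hWnear z (mem_ball.mp hz)).self_of_nhds, hWz]

end UCP

end Literature.Analysis.PDE.DbarCarleman
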